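import Summits.SmoothPoincare4.SmoothPoincare4.Theorems.CylinderEntropyCylinderRungTwoSurgeryTopology
import Summits.SmoothPoincare4.SmoothPoincare4.Theorems.CylinderEntropyCylinderRungTwoNullSurvivorsDie
import Summits.SmoothPoincare4.SmoothPoincare4.Theorems.CylinderEntropyImmortalAreaToFloor
import Summits.SmoothPoincare4.SmoothPoincare4.Theses.CylinderEntropy
import HarnessLib

/-!
# Route `CylinderEntropy`, crux `CylinderRungTwo` (stmt-SmoothPoincare4-7631), line `killing-flux`:
# THE PORT REDUCTION — crux ⇐ {CMS/DH port to `N` up to null survivors, CMS 2025 Cor. 1.5 (b), kernel certificates}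

Registered helper `helper_cylinderRungTwoOfPort` (lead c7, r21).  The end state of line `killing-flux` as ONE landed implication
concluding the route declaration BY NAME: `CylinderRungTwo` follows from
* (PORT) for every homotopy 4-sphere `M` and thin (`λ_cyl < 4/e`) end-separating embedding `ι : M → N = S⁴ × ℝ`, EITHER some slice of
  `M` is resolved by a mean curvature flow with neck surgery in `N` (`CylNeckSurgeryResolvable`) OR some compact connected carrier has an
  immortal thin smooth cylinder flow whose slices never separate the ends and each have a pocket — literally what the
  Chodosh–Mantoulidis–Schulze genericity theorem (Thm. 1.13, `n = 4`, `Λ = 4/e⁻`) and Daniels-Holgate surgery produce when re-run in `N`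
  (the registered research stub `stub_cylinderSurgeryFlowOrNull`; = the route item `CylinderSurgeryResolution`, stmt-18045, restricted to
  homotopy spheres and weakened by the null branch);
* (COR15B) the published named fact `Literature.Geometry.Riemannian.ChodoshMantoulidisSchulze2025_cor15b_four`;
* (CERT) the mid-scale kernel certificates on `[1/100, 10]` (LANDED computationally as `certMid_all`, p136454; a hypothesis here only
  because its axiom closure contains `Lean.ofReduceBool`).
Everything else is PROVED in the tree and consumed here: NULL SURVIVORS DIE (`helper_nullSurvivorsDiePocket`, this seat) turns (PORT) into the
surgery structure, the IMMORTAL HALF `areaToFloor` (item 17197, p144604) and (COR15B)+(CERT) recognise the immortal leaves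
(`helper_immortalLeafRecognition`), and the Daniels-Holgate backward induction + Kervaire–Milnor (`helper_cylNeckSurgeryTopology`,
`helper_cylinderRungTwoOfSurgery`, p137048) conclude `M ≅ S⁴`.

References: O. Chodosh, C. Mantoulidis, F. Schulze, *Mean curvature flow with generic low-entropy initial data II*, Duke Math. J. (2025),
Thm. 1.13, Cor. 1.5 (b); J. M. Daniels-Holgate, *Approximation of mean curvature flow with generic singularities by smooth flows with
surgery*, Adv. Math. 410 (2022), Thm. 1.3; R. S. Hamilton, Comm. Anal. Geom. 1 (1993).
-/

noncomputable section

-- the prescribed namespace `Summit.SmoothPoincare4.SmoothPoincare4.…` repeats `SmoothPoincare4`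
set_option linter.dupNamespace false

open MeasureTheory Set Function
open scoped Manifold ContDiff ENNReal Topology BigOperators ContinuousMap

namespace Summit.SmoothPoincare4.SmoothPoincare4.Cruxes.CylinderRungTwo.KillingFlux

open Literature.Geometry.Riemannian
open Literature.Geometry.Riemannian.SphericalCylinderEntropy (cylEntropy)
open Summit.SmoothPoincare4.SmoothPoincare4.Theses.CylinderEntropy (CylinderRungTwo CylinderSurgeryResolution)

/-- **Registered helper `helper_cylinderRungTwoOfPort` (lead c7, r21): the crux from the port, Cor. 1.5 (b) and the certificates.**
`CylinderRungTwo` follows from (PORT) the research stub `stub_cylinderSurgeryFlowOrNull` verbatim (surgery resolution OR a null survivor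
with pockets), (COR15B) `ChodoshMantoulidisSchulze2025_cor15b_four`, and (CERT) the mid-scale kernel certificates (landed computationally).
Proof: null survivors die (`helper_nullSurvivorsDiePocket`), so (PORT) gives the surgery structure; the immortal half `areaToFloor` (17197)
and (COR15B)+(CERT) feed the landed `helper_cylinderRungTwoOfSurgery`.
[cite: ChodoshMantoulidisSchulze2025, Thm. 1.13 and Cor. 1.5 (b)] [cite: DanielsHolgate2022, Thm. 1.3] -/
theorem helper_cylinderRungTwoOfPort :
    (∀ (M : Type) [TopologicalSpace M] [T2Space M] [SecondCountableTopology M]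
      [ChartedSpace (EuclideanSpace ℝ (Fin 4)) M] [IsManifold (𝓡 4) ∞ M],
      M ≃ₕ Metric.sphere (0 : EuclideanSpace ℝ (Fin 5)) 1 →
      ∀ ι : M → EuclideanSpace ℝ (Fin 6), Manifold.IsSmoothEmbedding (𝓡 4) (𝓡 6) ∞ ι →
      (∀ x, ∑ i : Fin 5, ι x (Fin.castSucc i) ^ 2 = 1) → SeparatesEnds (Set.range ι) →
      cylEntropy (Set.range ι) < ENNReal.ofReal (4 / Real.exp 1) →
      (∃ κ : M → EuclideanSpace ℝ (Fin 6), CylNeckSurgeryResolvable M κ) ∨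
        ∃ (P : Type) (_ : TopologicalSpace P) (_ : T2Space P) (_ : SecondCountableTopology P)
          (_ : ChartedSpace (EuclideanSpace ℝ (Fin 4)) P) (_ : IsManifold (𝓡 4) ∞ P) (_ : CompactSpace P)
          (_ : ConnectedSpace P) (_ : MeasurableSpace P) (_ : BorelSpace P)
          (F : ℝ → P → EuclideanSpace ℝ (Fin 6)) (ν : ℝ → P → EuclideanSpace ℝ (Fin 6)) (T : ℝ),
          IsCylinderMCF P F ν T ∧ (∀ t, T ≤ t → cylEntropy (Set.range (F t)) < 2) ∧
            (∀ t, T ≤ t → ¬ SeparatesEnds (Set.range (F t))) ∧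
            (∀ t, T ≤ t → ∃ (z : EuclideanSpace ℝ (Fin 6)) (R : ℝ), ∑ i : Fin 5, z (Fin.castSucc i) ^ 2 = 1 ∧
              z ∉ Set.range (F t) ∧ ∀ b : EuclideanSpace ℝ (Fin 6), ∑ i : Fin 5, b (Fin.castSucc i) ^ 2 = 1 → b 5 ≤ -R →
                ¬ JoinedIn ({z : EuclideanSpace ℝ (Fin 6) | ∑ i : Fin 5, z (Fin.castSucc i) ^ 2 = 1} \ Set.range (F t)) z b)) →
    Literature.Geometry.Riemannian.ChodoshMantoulidisSchulze2025_cor15b_four →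
    (∀ T : ℝ, 1 / 100 ≤ T → T ≤ 10 →
      ∃ (n : ℕ) (σ τ w : Fin n → ℝ) (c : ℝ), (∀ j, 0 < τ j) ∧ (∀ j, 0 ≤ w j) ∧ 0 ≤ c ∧ (∑ j, w j) + c ≤ 147 / 100 ∧
        ∀ u s : ℝ, -1 ≤ s → s ≤ 1 →
          (8 * Real.pi ^ 2 / 3) * ((4 * Real.pi * T) ^ 2)⁻¹ * Real.exp (4 * u) *
              Real.exp (-(Real.exp (2 * u) - 2 * Real.exp u * s + 1) / (4 * T)) ≤
            (∑ j, w j * (Literature.Geometry.Riemannian.SphericalCylinderEntropy.zonal (τ j) s *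
              Real.exp (-(u - σ j) ^ 2 / (4 * τ j)))) + c) →
    Summit.SmoothPoincare4.SmoothPoincare4.Theses.CylinderEntropy.CylinderRungTwo :=
  fun hport hb hcert =>
    helper_cylinderRungTwoOfSurgery
      (fun M _ _ _ _ _ e ι hι hN hsep hent =>
        (hport M e ι hι hN hsep hent).resolve_right helper_nullSurvivorsDiePocket)
      areaToFloor hb hcert

/-- **The route's research item implies the line's research stub.**  `CylinderSurgeryResolution` (stmt-SmoothPoincare4-18045: least-predicate
phrasing, all compact connected carriers) gives, for homotopy 4-spheres, the first disjunct of `stub_cylinderSurgeryFlowOrNull` — instantiate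
the least predicate at the inductive `CylNeckSurgeryResolvable` (its six constructors are the six closure rules); a homotopy 4-sphere is
compact and connected (tree).  So after r21 the crux hinges on item 18045 and the published fact Cor. 1.5 (b) only.
[cite: DanielsHolgate2022, §2.1 Def. 2.18–2.20] -/
theorem orNull_of_cylinderSurgeryResolution (hX : CylinderSurgeryResolution) :
    ∀ (M : Type) [TopologicalSpace M] [T2Space M] [SecondCountableTopology M]
      [ChartedSpace (EuclideanSpace ℝ (Fin 4)) M] [IsManifold (𝓡 4) ∞ M],
      M ≃ₕ Metric.sphere (0 : EuclideanSpace ℝ (Fin 5)) 1 →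
      ∀ ι : M → EuclideanSpace ℝ (Fin 6), Manifold.IsSmoothEmbedding (𝓡 4) (𝓡 6) ∞ ι →
      (∀ x, ∑ i : Fin 5, ι x (Fin.castSucc i) ^ 2 = 1) → SeparatesEnds (Set.range ι) →
      cylEntropy (Set.range ι) < ENNReal.ofReal (4 / Real.exp 1) →
      (∃ κ : M → EuclideanSpace ℝ (Fin 6), CylNeckSurgeryResolvable M κ) ∨
        ∃ (P : Type) (_ : TopologicalSpace P) (_ : T2Space P) (_ : SecondCountableTopology P)
          (_ : ChartedSpace (EuclideanSpace ℝ (Fin 4)) P) (_ : IsManifold (𝓡 4) ∞ P) (_ : CompactSpace P)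
          (_ : ConnectedSpace P) (_ : MeasurableSpace P) (_ : BorelSpace P)
          (F : ℝ → P → EuclideanSpace ℝ (Fin 6)) (ν : ℝ → P → EuclideanSpace ℝ (Fin 6)) (T : ℝ),
          IsCylinderMCF P F ν T ∧ (∀ t, T ≤ t → cylEntropy (Set.range (F t)) < 2) ∧
            (∀ t, T ≤ t → ¬ SeparatesEnds (Set.range (F t))) ∧
            (∀ t, T ≤ t → ∃ (z : EuclideanSpace ℝ (Fin 6)) (R : ℝ), ∑ i : Fin 5, z (Fin.castSucc i) ^ 2 = 1 ∧
              z ∉ Set.range (F t) ∧ ∀ b : EuclideanSpace ℝ (Fin 6), ∑ i : Fin 5, b (Fin.castSucc i) ^ 2 = 1 → b 5 ≤ -R →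
                ¬ JoinedIn ({z : EuclideanSpace ℝ (Fin 6) | ∑ i : Fin 5, z (Fin.castSucc i) ^ 2 = 1} \ Set.range (F t)) z b) := by
  intro M _ _ _ _ _ e ι hι hN hsep hent
  haveI : CompactSpace M :=
    Literature.Topology.FourManifolds.compactSpace_of_homotopyEquiv_sphere_four_holds M e
  haveI : PathConnectedSpace M := by
    haveI := Literature.Topology.FourManifolds.pathConnectedSpace_sphere_four
    exact Literature.Topology.FourManifolds.pathConnectedSpace_of_homotopyEquiv e
  obtain ⟨κ, hκ⟩ := hX M ι hι hN hsep hent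
  refine Or.inl ⟨κ, hκ (fun P _ _ κ' => CylNeckSurgeryResolvable P κ') ?_ ?_ ?_ ?_ ?_ ?_⟩
  · intro P _ _ hP κ'
    exact CylNeckSurgeryResolvable.discard hP κ'
  · intro P _ _ _ _ F ν T₀ T₁ hT hU hemb hN' hi hun hνN hνs hvel h
    exact CylNeckSurgeryResolvable.flow hT ⟨hU, hemb, hN', hi, hun, hνN, hνs, hvel⟩ h
  · intro P P' _ _ _ _ _ κ' e' h
    exact CylNeckSurgeryResolvable.of_diffeomorph h e'
  · intro P _ _ _ _ κ' ψ D₁ D₂ hdisj hcover κ₁ κ₂ h₁ h₂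
    exact CylNeckSurgeryResolvable.cut κ' D₁ D₂ hdisj hcover κ₁ κ₂ h₁ h₂
  · intro P _ _ _ _ κ' ψ hψ ho hns μ h
    exact CylNeckSurgeryResolvable.cutNonseparating κ' hψ ho hns μ h
  · intro P _ _ _ _ _ _ _ F ν T hF hsep' hthin
    exact CylNeckSurgeryResolvable.immortal hF hsep' hthin

/-- **THE END STATE OF THE LINE**: `CylinderRungTwo ⇐ CylinderSurgeryResolution (item 18045) + Cor. 1.5 (b) (published) + the kernel
certificates (landed computationally)`. [cite: ChodoshMantoulidisSchulze2025, Thm. 1.13 and Cor. 1.5 (b)] [cite: DanielsHolgate2022, Thm. 1.3] -/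
theorem cylinderRungTwo_of_resolution_cor15b_certificates (hX : CylinderSurgeryResolution)
    (hb : Literature.Geometry.Riemannian.ChodoshMantoulidisSchulze2025_cor15b_four)
    (hcert : ∀ T : ℝ, 1 / 100 ≤ T → T ≤ 10 →
      ∃ (n : ℕ) (σ τ w : Fin n → ℝ) (c : ℝ), (∀ j, 0 < τ j) ∧ (∀ j, 0 ≤ w j) ∧ 0 ≤ c ∧ (∑ j, w j) + c ≤ 147 / 100 ∧
        ∀ u s : ℝ, -1 ≤ s → s ≤ 1 →
          (8 * Real.pi ^ 2 / 3) * ((4 * Real.pi * T) ^ 2)⁻¹ * Real.exp (4 * u) *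
              Real.exp (-(Real.exp (2 * u) - 2 * Real.exp u * s + 1) / (4 * T)) ≤
            (∑ j, w j * (Literature.Geometry.Riemannian.SphericalCylinderEntropy.zonal (τ j) s *
              Real.exp (-(u - σ j) ^ 2 / (4 * τ j)))) + c) :
    Summit.SmoothPoincare4.SmoothPoincare4.Theses.CylinderEntropy.CylinderRungTwo :=
  helper_cylinderRungTwoOfPort (orNull_of_cylinderSurgeryResolution hX) hb hcert

end Summit.SmoothPoincare4.SmoothPoincare4.Cruxes.CylinderRungTwo.KillingFlux

end
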